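import Literature.MathematicalPhysics.QuantumFieldTheory.Balaban1983to89.B12Eq118Analyticity263
import Literature.MathematicalPhysics.QuantumFieldTheory.Balaban1983to89.B12CauchyRemainder354
import Mathlib.Analysis.Calculus.MeanValue
import Mathlib.Analysis.SpecialFunctions.Pow.Real
import Mathlib.Analysis.SpecialFunctions.Log.Basic
import Mathlib.Algebra.Order.Field.GeomSum
import HarnessLib

/-!
# Crux `NT` / seam `UVSeamRec.stub_floorsEngine` (S-B): the ANALYTICITY-RADIUS READOUT over Bałaban's small-field tower
# (card `analyticity-radius-readout`, kernel-checked in the tree) — method lane for the conjugate response (CR)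

Helper file (`--supports stmt-QuantumFields-20043`; owner RULINGS R78/R87) of the fleet lead `ym-spine-19353-p1`,
kernel-checking in the tree, def-free, crux-ideate card I `analyticity-radius-readout` (seat `ym-cruxidea-19353-1` g9,
HOME sketch `SketchI.lean`, rc 0).  WHICH CLAUSE IT SERVES: the EVALUATION ROUTE (H1, unit-coefficient conjugacy through
Bałaban's effective densities) of the conjugate-response clause (CR) of `…UVSeamRecFloorsEngineOfConjugateResponse`
(p540929) — the method lane for the R87 residual MF of conjunct 2 of the REGISTERED `UVSeamRec.stub_floorsEngine`.

THE LEVER (transfer from Bałaban's N-vector low-temperature expansion, CMP 198 Prop. 2.2): the last-scale effective action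
is a sum of terms `𝐄^{(j)}(X, g, ·)` HOLOMORPHIC on `U^c_j(X, α₀, α₁)` with the sup bound (1.18) `‖𝐄‖ ≤ E₀e^{−κ d_j(X)}`
(tree `Step.SFHyp.bound118`, `B12.Eq118Analyticity263.SFHypAnalytic`); a derivative in ANY direction along which the
complex affine line stays in the space up to radius `R` costs `sup/R` (Cauchy):
* §1 `radius_readout`, `radius_readout_of_bound` — over the tree's `SFTower`;
* §2 `mixed_cauchy` — the two-radius (source × fluctuation) estimate;
* §3 `oscillation_le` — a large radius makes a bounded holomorphic term almost constant on the typical region;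
* §4 `scale_sum_uniform(_const)` — CMP 109 (0.30): the irrelevant terms' fluctuation dependence is summable
  UNIFORMLY IN THE NUMBER OF STEPS;
* §5 `relRadius_tendsto_zero` — the relative radius `g/α₁(g) → 0` for the printed [III] radii (`Step.LFConsts.alpha1`);
* §6 `floor_of_relative_error` — a relative-error readout turns an explicit tree term into a floor.

HONEST FRAMING.  Cauchy estimates and arithmetic over the tree's typed Bałaban structures; the density-level input (SCF)
of the card is NOT typed here; nothing about NT, the seam or a mass gap. [cite: Balaban1989LargeFieldI, (1.18);
Balaban1987RG1, (0.30)]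
-/

set_option autoImplicit false

namespace Summit.QuantumFields.YangMills.Cruxes.NT.RadiusReadout

open Literature.MathematicalPhysics.QuantumFieldTheory.Balaban1983to89 Step Set Metric Filter
open scoped Topology

/-! ## §I1  RADIUS READOUT — the first lemma (over the tree's small-field tower) -/

section Readout

variable {P : Params} {G : Type*} [GaugeGroup G] {Φ 𝒢 : Type*} [NormedAddCommGroup Φ] [NormedSpace ℂ Φ]

/-- **Radius readout.**  For a term `𝐄^{(j)}(X, g, ·)` of a small-field tower satisfying the inductive hypotheses at scale `k`
((1.18) `bound118` + the analyticity clause), a base point `φ₀` and a direction `H` such that the complex affine line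
`t ↦ φ₀ + t • H` stays inside `U^c_j(X, α₀, α₁)` for `‖t‖ < R`, the derivative at `t = 0` is bounded by
`E₀ e^{−κ d_j(X)} / r` for every `r < R` (Cauchy estimate on the circle of radius `r`, print's (3.15)–(3.17) move,
CMP 109 p. 273, applied to an OBSERVABLE direction instead of the fluctuation-field direction).
The card uses it at `j ≤ k = K` (last scale) with `H` = a unit fluctuation of the unit-lattice field, `R ≍ α₁/g_K`. -/
theorem radius_readout {T : SFTower P G Φ 𝒢} {c : SFConsts} {k : ℕ}
    (hT : SFHyp T c k) (hA : B12.Eq118Analyticity263.SFHypAnalytic T c k)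
    {j : ℕ} (h1 : 1 ≤ j) (hj : j ≤ k) (X : (T.sys j).Dom) {g : ℝ} (hg0 : 0 ≤ g) (hgγ : g ≤ c.γ)
    (φ₀ H : Φ) {r R : ℝ} (hr : 0 < r) (hrR : r < R)
    (hmaps : MapsTo (fun t : ℂ => φ₀ + t • H) (ball (0:ℂ) R) (T.space j X c.α₀ c.α₁)) :
    ‖deriv (fun t : ℂ => T.E j X g (φ₀ + t • H)) 0‖ ≤ c.E₀ * Real.exp (-c.κ * (T.sys j).dj X) / r := by
  refine B12CauchyRemainder354.ineq317 hr hrR (hA.differentiableOn_E_affineLine h1 hj X hg0 hgγ φ₀ H hmaps) ?_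
  intro t ht
  have htR : t ∈ ball (0:ℂ) R := by
    rw [mem_ball_zero_iff]
    rw [mem_sphere_zero_iff_norm] at ht
    linarith
  exact hT.bound118 j h1 hj X g _ hg0 hgγ (hmaps htR)

/-- The same with the sup replaced by any uniform bound `M` on the image circle (the form used scale by scale with the
IRRELEVANT bound (0.29) `M = O(1)(L^jη)^{4+α} e^{−κ d_j(X)}` in place of (1.18), CMP 109 p. 258 and p. 281:
«they satisfy bounds of the form (0.28) on their domains of analyticity»). -/
theorem radius_readout_of_bound {T : SFTower P G Φ 𝒢} {c : SFConsts} {k : ℕ}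
    (hA : B12.Eq118Analyticity263.SFHypAnalytic T c k)
    {j : ℕ} (h1 : 1 ≤ j) (hj : j ≤ k) (X : (T.sys j).Dom) {g : ℝ} (hg0 : 0 ≤ g) (hgγ : g ≤ c.γ)
    (φ₀ H : Φ) {r R M : ℝ} (hr : 0 < r) (hrR : r < R)
    (hmaps : MapsTo (fun t : ℂ => φ₀ + t • H) (ball (0:ℂ) R) (T.space j X c.α₀ c.α₁))
    (hM : ∀ t ∈ sphere (0:ℂ) r, ‖T.E j X g (φ₀ + t • H)‖ ≤ M) :
    ‖deriv (fun t : ℂ => T.E j X g (φ₀ + t • H)) 0‖ ≤ M / r :=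
  B12CauchyRemainder354.ineq317 hr hrR (hA.differentiableOn_E_affineLine h1 hj X hg0 hgγ φ₀ H hmaps) hM

end Readout

/-! ## §I2  MIXED CAUCHY — source radius × fluctuation radius -/

section Mixed

variable {F : Type*} [NormedAddCommGroup F] [NormedSpace ℂ F]

/-- **Two-radius Cauchy estimate.**  A two-parameter family `Ψ s z` (source parameter `s`, fluctuation parameter `z`),
holomorphic in `z` on `ball 0 Rz` for each `s`, whose `z`-derivative at `0` is holomorphic in `s` on `ball 0 Rs`, and with
`‖Ψ s z‖ ≤ M`: the mixed derivative `∂_s ∂_z Ψ (0,0)` is bounded by `M / (rz · rs)`.  In the card: `Rs ≍ c₀/(g_K²‖v‖∞)`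
(coupling-modulation radius of (SCF)), `Rz ≍ α₁/g_K` (fluctuation radius), `M = E₀e^{−κd}` — the fluctuation dependence of
`∂_s`(non-explicit terms), i.e. of `E[Ṽ^θ | V] −` (classical part), is `O(E₀ g_K² · g_K/α₁)` against the classical part's
`O(g_K²)`: relative error `g_K/α₁ → 0` (§I5).  (`hs` is a hypothesis: joint holomorphy gives it, not re-proved here.) -/
theorem mixed_cauchy {Ψ : ℂ → ℂ → F} {rs Rs rz Rz M : ℝ} (hrs : 0 < rs) (hrsR : rs < Rs) (hrz : 0 < rz) (hrzR : rz < Rz)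
    (hz : ∀ s ∈ ball (0:ℂ) Rs, DifferentiableOn ℂ (Ψ s) (ball 0 Rz))
    (hs : DifferentiableOn ℂ (fun s => deriv (Ψ s) 0) (ball 0 Rs))
    (hM : ∀ s ∈ ball (0:ℂ) Rs, ∀ z ∈ sphere (0:ℂ) rz, ‖Ψ s z‖ ≤ M) :
    ‖deriv (fun s => deriv (Ψ s) 0) 0‖ ≤ M / rz / rs := by
  refine B12CauchyRemainder354.ineq317 hrs hrsR hs ?_
  intro s hs'
  have hsR : s ∈ ball (0:ℂ) Rs := by
    rw [mem_ball_zero_iff]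
    rw [mem_sphere_zero_iff_norm] at hs'
    linarith
  exact B12CauchyRemainder354.ineq317 hrz hrzR (hz s hsR) (hM s hsR)

end Mixed

/-! ## §I3  OSCILLATION ON THE TYPICAL REGION — a large radius makes a bounded holomorphic term almost constant -/

section Oscillation

variable {F : Type*} [NormedAddCommGroup F] [NormedSpace ℂ F]

/-- **Oscillation bound.**  `f` holomorphic on `ball 0 ρ` with `‖f‖ ≤ M` there; on the typical region `‖z‖ ≤ ζ` with
`ζ + r' < ρ` one has `‖f z − f 0‖ ≤ (M / r') ‖z‖` (Cauchy bound `M/r'` for `f'` at every point of the closed ball of radius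
`ζ`, then the mean-value inequality).  In the card: in fluctuation-normalised unit-lattice variables the non-explicit last-scale
terms are holomorphic on radius `ρ ≍ α₁/g_K → ∞` with `M = E₀e^{−κd}` ABSOLUTE, so on `‖ζ'‖ ≤ ζ_max = o(ρ)` they oscillate by
`O(E₀ ζ_max/ρ) → 0`: the last-scale block-field law is the explicit classical-action law up to a uniformly small log-density
perturbation on the typical region (the complement is Gaussian-rare), which is what the coarse-side covariance readout
(card B (H2), card G LMF remainder, sibling card 12's δ-sandwich constant) needs. -/
theorem oscillation_le {f : ℂ → F} {ρ ζ r' M : ℝ}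
    (hf : DifferentiableOn ℂ f (ball 0 ρ)) (hM : ∀ w ∈ ball (0:ℂ) ρ, ‖f w‖ ≤ M)
    (hr' : 0 < r') (hsum : ζ + r' < ρ) {z : ℂ} (hz : ‖z‖ ≤ ζ) :
    ‖f z - f 0‖ ≤ M / r' * ‖z‖ := by
  have hζ : 0 ≤ ζ := le_trans (norm_nonneg z) hz
  -- closed ball of radius r' around any point of norm ≤ ζ lies inside ball 0 ρ
  have hincl : ∀ x : ℂ, ‖x‖ ≤ ζ → closedBall x r' ⊆ ball 0 ρ := by
    intro x hx w hw
    rw [mem_closedBall, dist_eq_norm] at hw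
    rw [mem_ball_zero_iff]
    calc ‖w‖ = ‖(w - x) + x‖ := by rw [sub_add_cancel]
      _ ≤ ‖w - x‖ + ‖x‖ := norm_add_le _ _
      _ < ρ := by linarith
  have hderiv : ∀ x ∈ closedBall (0:ℂ) ζ, ‖deriv f x‖ ≤ M / r' := by
    intro x hx
    rw [mem_closedBall, dist_zero_right] at hx
    have hsub := hincl x hx
    have hdc : DiffContOnCl ℂ f (ball x r') :=
      ⟨hf.mono (ball_subset_closedBall.trans hsub),
        (hf.mono (closure_ball_subset_closedBall.trans hsub)).continuousOn⟩
    refine Complex.norm_deriv_le_of_forall_mem_sphere_norm_le hr' hdc ?_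
    intro w hw
    exact hM w (hsub (sphere_subset_closedBall hw))
  have hdiff : ∀ x ∈ closedBall (0:ℂ) ζ, DifferentiableAt ℂ f x := by
    intro x hx
    rw [mem_closedBall, dist_zero_right] at hx
    have hxρ : x ∈ ball (0:ℂ) ρ := by rw [mem_ball_zero_iff]; linarith
    exact hf.differentiableAt (isOpen_ball.mem_nhds hxρ)
  have h := (convex_closedBall (0:ℂ) ζ).norm_image_sub_le_of_norm_deriv_le hdiff hderiv
    (mem_closedBall_self hζ) (by rwa [mem_closedBall, dist_zero_right])
  simpa using h

end Oscillation

/-! ## §I4  SCALE SUM — the irrelevant terms' fluctuation dependence is summable UNIFORMLY IN THE NUMBER OF STEPS -/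

/-- **(0.30) typed.**  With `L > 1`, `α > 0`: in unit-lattice terms there are `(L^4)^m` localization cubes of the scale
`j = k − m` per unit cube and each `j`-term's background dependence carries the irrelevant factor `(L^jη)^{4+α} =
(L^{−(4+α)})^m` ((0.29), CMP 109 p. 258, valid «on their domains of analyticity», p. 281); the scale sum is bounded by
`1/(1 − L^{−α})` for EVERY number of steps `k` — «the only dependence on k is through the volume |T_η|» (p. 258). -/
theorem scale_sum_uniform {L α : ℝ} (hL : 1 < L) (hα : 0 < α) (k : ℕ) :
    ∑ m ∈ Finset.range k, (L ^ (4:ℝ)) ^ m * (L ^ (-(4 + α))) ^ m ≤ 1 / (1 - L ^ (-α)) := by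
  have hL0 : 0 < L := by linarith
  have hq : L ^ (4:ℝ) * L ^ (-(4 + α)) = L ^ (-α) := by
    rw [← Real.rpow_add hL0]
    congr 1
    ring
  have hq0 : 0 ≤ L ^ (-α) := Real.rpow_nonneg hL0.le _
  have hq1 : L ^ (-α) < 1 := Real.rpow_lt_one_of_one_lt_of_neg hL (by linarith)
  calc ∑ m ∈ Finset.range k, (L ^ (4:ℝ)) ^ m * (L ^ (-(4 + α))) ^ m
      = ∑ m ∈ Finset.Ico 0 k, (L ^ (-α)) ^ m := by
        rw [Finset.range_eq_Ico]
        refine Finset.sum_congr rfl fun m _ => ?_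
        rw [← mul_pow, hq]
    _ ≤ (L ^ (-α)) ^ 0 / (1 - L ^ (-α)) := geom_sum_Ico_le_of_lt_one hq0 hq1
    _ = 1 / (1 - L ^ (-α)) := by rw [pow_zero]

/-- The same with a constant `C ≥ 0` in front of every irrelevant bound (print's `O(1)`). -/
theorem scale_sum_uniform_const {L α C : ℝ} (hL : 1 < L) (hα : 0 < α) (hC : 0 ≤ C) (k : ℕ) :
    ∑ m ∈ Finset.range k, C * ((L ^ (4:ℝ)) ^ m * (L ^ (-(4 + α))) ^ m) ≤ C / (1 - L ^ (-α)) := by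
  rw [← Finset.mul_sum, div_eq_mul_one_div]
  exact mul_le_mul_of_nonneg_left (scale_sum_uniform hL hα k) hC

/-! ## §I5  THE SMALL PARAMETER — the relative radius `g / α_{1}(g) → 0` for the printed [III] radii -/

/-- **Relative radius.**  With the large-field-complete radii (2.28) `α_{1,j} = g_j C₁ (log g_j⁻²)^{q₁}` (tree
`Step.LFConsts.alpha1`, «q₀, q₁ integers greater than 1, C₀, C₁ sufficiently large», CMP 119 p. 259) the ratio
(typical fluctuation)/(analyticity radius) `= g/α₁(g) = 1/(C₁ (log g⁻²)^{q₁})` tends to `0` as `g → 0⁺` — slowly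
(polylogarithmically); with the [I] radii (α₁ absolute, CMP 109 p. 263) it is `g/α₁`, linearly small. -/
theorem relRadius_tendsto_zero (c : LFConsts) (hC : 0 < c.C₁) (hq : c.q₁ ≠ 0) :
    Tendsto (fun g : ℝ => g / c.alpha1 g) (𝓝[>] 0) (𝓝 0) := by
  -- −log g → +∞ as g → 0⁺, hence C₁ (2(−log g))^{q₁} → +∞ and its inverse → 0
  have h1 : Tendsto (fun g : ℝ => -Real.log g) (𝓝[>] 0) atTop :=
    tendsto_neg_atBot_atTop.comp Real.tendsto_log_nhdsGT_zero
  have h2 : Tendsto (fun g : ℝ => 2 * (-Real.log g)) (𝓝[>] 0) atTop := h1.const_mul_atTop (by norm_num)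
  have h3 : Tendsto (fun g : ℝ => (2 * (-Real.log g)) ^ c.q₁) (𝓝[>] 0) atTop := (tendsto_pow_atTop hq).comp h2
  have h4 : Tendsto (fun g : ℝ => c.C₁ * (2 * (-Real.log g)) ^ c.q₁) (𝓝[>] 0) atTop := h3.const_mul_atTop hC
  have h5 : Tendsto (fun g : ℝ => (c.C₁ * (2 * (-Real.log g)) ^ c.q₁)⁻¹) (𝓝[>] 0) (𝓝 0) := h4.inv_tendsto_atTop
  refine h5.congr' ?_
  have hev : ∀ᶠ g : ℝ in 𝓝[>] 0, g ∈ Ioo (0:ℝ) 1 := Ioo_mem_nhdsGT (by norm_num : (0:ℝ) < 1)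
  filter_upwards [hev] with g hg
  obtain ⟨hg0, hg1⟩ := hg
  have hlog : Real.log (g ^ 2)⁻¹ = 2 * (-Real.log g) := by
    rw [Real.log_inv, Real.log_pow]
    push_cast
    ring
  have hneg : 0 < -Real.log g := by
    have := Real.log_neg hg0 hg1
    linarith
  have hPpos : 0 < (2 * (-Real.log g)) ^ c.q₁ := pow_pos (by linarith) _
  unfold LFConsts.alpha1
  rw [hlog]
  field_simp

/-! ## §I6  FLOOR TRANSFER — a relative-error readout turns the explicit tree term into a floor -/

/-- If a quantity `x` (a coarse covariance) is within relative error `δ < 1` of an explicit positive tree term `t`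
(`2 g_K⁴ tr(C Q^θ C Q) > 0`, SketchH §H6), then `x ≥ (1 − δ) t > 0`: the readout's output is exactly the shape of the
(CR)/(MF) floor hypothesis of the registered seam (`stub_floorsEngine`), with `δ = O(g_K) + O(E₀ g_K/α₁)`. -/
theorem floor_of_relative_error {x t δ : ℝ} (ht : 0 < t) (hδ : δ < 1) (h : |x - t| ≤ δ * t) :
    (1 - δ) * t ≤ x ∧ 0 < x := by
  have h1 : -(δ * t) ≤ x - t := (abs_le.mp h).1
  refine ⟨by nlinarith, ?_⟩
  have : 0 < (1 - δ) * t := mul_pos (by linarith) ht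
  nlinarith

end Summit.QuantumFields.YangMills.Cruxes.NT.RadiusReadout
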